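import Literature.AlgebraicGeometry.Resolution.LogResolutionOfClosedSubset
import Literature.AlgebraicGeometry.Resolution.SubschemeRegularStalks
import Literature.AlgebraicGeometry.Resolution.CobordantBlowupRegularCentre
import Literature.AlgebraicGeometry.Resolution.FormalNormalCrossingsAlgebra
import Literature.AlgebraicGeometry.Resolution.CoefficientIdealRestriction
import Literature.AlgebraicGeometry.Resolution.MonomialMarkedIdeals
import Literature.AlgebraicGeometry.Resolution.SmoothOfRegularPerfectField
import Literature.AlgebraicGeometry.Motives.AbelianVarietyProofs
import Literature.AlgebraicGeometry.Motives.VarietiesDimensionProofs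
import Literature.AlgebraicGeometry.Motives.CyclesDimensionProofs
import HarnessLib

/-!
# The strata of a simple normal crossing configuration are smooth of the expected dimension

Topic: `Literature/AlgebraicGeometry/Resolution`. Let `W` be an integral scheme, smooth of
relative dimension `n` over a perfect field `k`, and `E` a finite list of ideal sheaves on `W`
with simple normal crossings (`HasSNC E`, BGMW Def. 3.1.1: at every point a regular system of
parameters `u_1, …, u_N` of `𝒪_{W,x}` such that each member of `E` through `x` is `(u_i)` for some
`i`, distinct members getting distinct parameters). Then for every finite set `S` of members of
`E` the closed subscheme `E_S = V(Σ_{D ∈ S} D)` ("stratum") is smooth over `k` of relative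
dimension `n - |S|` (`smoothOfRelativeDimension_stratum_of_hasSNC`) — the standard local picture
of a simple normal crossing divisor (Kollár 2007, 3.24; Voisin, *Hodge Theory II*, §4.2.2:
"`D_I = ⋂_{i∈I} D_i` is a smooth subvariety of codimension `|I|`").

Proof: on stalks `𝒪_{E_S,x} = 𝒪_{W,x}/(u_i)_{i ∈ T}` (`|T| = |S|`) is a regular local ring
(`isRegularLocalRing_quotient_span_range`) of dimension `dim 𝒪_{W,x} - |S|` (Krull's height
theorem for `≥`, the number of generators of the maximal ideal of the regular quotient for `≤`:
`isRegularLocalRing_and_ringKrullDim_quotient_span_image`); so `E_S` is regular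
(`Scheme.isRegular_subscheme_iff`), hence smooth over the perfect field `k`
(`smooth_of_isRegular_of_perfectField`); its relative dimension near any point is read off at a
closed point of the neighbourhood (closed points are dense, `W` being Jacobson), where
`dim 𝒪_{W,x} = n` (`height_add_coheight_eq_of_smoothOfRelativeDimension`). Everything is proved; no
named facts (D-0026).

## References

* J. Kollár, *Lectures on Resolution of Singularities* (2007), 3.24 (simple normal crossings).
* C. Voisin, *Hodge Theory and Complex Algebraic Geometry II* (2003), §4.2.2.
* H. Matsumura, *Commutative Ring Theory* (1986), Thm. 14.2.
-/

noncomputable section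

open CategoryTheory CategoryTheory.Limits AlgebraicGeometry TopologicalSpace IsLocalRing

namespace Literature.AlgebraicGeometry.Resolution

universe u

/-! ## §1 Quotients of a regular local ring by part of a regular system of parameters -/

/-- **Quotient of a regular local ring by part of a regular system of parameters.** Let `R` be
a regular local ring of dimension `N` with regular system of parameters `u_1, …, u_N`
(`(u_1, …, u_N) = 𝔪`) and `T ⊆ {1, …, N}`. Then `R/(u_i)_{i ∈ T}` is a regular local ring of
dimension `N - |T|` (Matsumura, Thm. 14.2; `≥` by Krull's height theorem, `≤` as its maximal ideal
is generated by the `N - |T|` remaining parameters). [cite: Matsumura1987, Thm. 14.2] -/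
theorem isRegularLocalRing_and_ringKrullDim_quotient_span_image {R : Type u} [CommRing R]
    [IsRegularLocalRing R] {N : ℕ} (hN : ringKrullDim R = N) (u : Fin N → R)
    (hu : Ideal.span (Set.range u) = maximalIdeal R) (T : Finset (Fin N)) :
    IsRegularLocalRing (R ⧸ Ideal.span (u '' ↑T)) ∧
      ringKrullDim (R ⧸ Ideal.span (u '' ↑T)) = (N - T.card : ℕ) := by
  classical
  have hum : ∀ i, u i ∈ maximalIdeal R := fun i ↦ hu ▸ Ideal.subset_span ⟨i, rfl⟩
  have hli := linearIndependent_toCotangent_of_span_eq_maximalIdeal hN u hu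
  -- the sub-family indexed by `T`
  set f : Fin T.card → R := fun j ↦ u (T.equivFin.symm j) with hf
  have hrange : Set.range f = u '' ↑T := by
    ext r
    constructor
    · rintro ⟨j, rfl⟩
      exact ⟨_, (T.equivFin.symm j).2, rfl⟩
    · rintro ⟨i, hi, rfl⟩
      exact ⟨T.equivFin ⟨i, hi⟩, by simp [hf]⟩
  have hreg : IsRegularLocalRing (R ⧸ Ideal.span (u '' ↑T)) := by
    rw [← hrange]
    refine isRegularLocalRing_quotient_span_range f (fun j ↦ hum _) ?_
    have hinj : Function.Injective (fun j : Fin T.card ↦ ((T.equivFin.symm j : T) : Fin N)) :=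
      fun a b h ↦ T.equivFin.symm.injective (Subtype.ext h)
    exact hli.comp _ hinj
  refine ⟨hreg, ?_⟩
  set J : Ideal R := Ideal.span (u '' ↑T) with hJ
  -- `≥`: Krull's height theorem
  have hge : (N : WithBot ℕ∞) ≤ ringKrullDim (R ⧸ J) + T.card := by
    have hjac : ((T.image u : Finset R) : Set R) ⊆ Ring.jacobson R := by
      intro r hr
      rw [Finset.coe_image] at hr
      obtain ⟨i, -, rfl⟩ := hr
      rw [IsLocalRing.ringJacobson_eq_maximalIdeal]
      exact hum i
    have h1 := ringKrullDim_le_ringKrullDim_quotient_add_card (T.image u) hjac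
    rw [Finset.coe_image, ← hJ, hN] at h1
    refine h1.trans (add_le_add le_rfl ?_)
    exact_mod_cast Finset.card_image_le
  -- `≤`: the maximal ideal of `R/J` is generated by the `u_i`, `i ∉ T`
  haveI := hreg
  have hle : ringKrullDim (R ⧸ J) ≤ ((N - T.card : ℕ) : WithBot ℕ∞) := by
    have hdimQ := IsRegularLocalRing.spanFinrank_maximalIdeal (R := R ⧸ J)
    rw [← hdimQ]
    have hgen : Ideal.span ((Tᶜ.image (Ideal.Quotient.mk J ∘ u) : Finset (R ⧸ J)) : Set (R ⧸ J)) =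
        maximalIdeal (R ⧸ J) := by
      rw [maximalIdeal_quotient_eq_map J, ← hu, Ideal.map_span, Finset.coe_image]
      refine le_antisymm (Ideal.span_mono ?_) (Ideal.span_le.mpr ?_)
      · rintro _ ⟨i, -, rfl⟩
        exact ⟨u i, ⟨i, rfl⟩, rfl⟩
      · rintro _ ⟨_, ⟨i, rfl⟩, rfl⟩
        by_cases hi : i ∈ T
        · have h0 : Ideal.Quotient.mk J (u i) = 0 :=
            Ideal.Quotient.eq_zero_iff_mem.mpr (Ideal.subset_span ⟨i, hi, rfl⟩)
          rw [h0]
          exact zero_mem _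
        · exact Ideal.subset_span ⟨i, Finset.mem_coe.mpr (Finset.mem_compl.mpr hi), rfl⟩
    have h2 : (maximalIdeal (R ⧸ J)).spanFinrank ≤ (Tᶜ.image (Ideal.Quotient.mk J ∘ u)).card := by
      rw [← hgen]
      have := Submodule.spanFinrank_span_le_ncard_of_finite (R := R ⧸ J)
        (s := ((Tᶜ.image (Ideal.Quotient.mk J ∘ u) : Finset (R ⧸ J)) : Set (R ⧸ J)))
        (Finset.finite_toSet _)
      rwa [Set.ncard_coe_finset] at this
    have h3 : (Tᶜ.image (Ideal.Quotient.mk J ∘ u)).card ≤ N - T.card :=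
      Finset.card_image_le.trans (by rw [Finset.card_compl, Fintype.card_fin])
    exact_mod_cast h2.trans h3
  -- conclude
  have hfin : ∃ m : ℕ, ringKrullDim (R ⧸ J) = m := by
    have h := IsRegularLocalRing.spanFinrank_maximalIdeal (R := R ⧸ J)
    exact ⟨_, h.symm⟩
  obtain ⟨m, hm⟩ := hfin
  rw [hm] at hge hle ⊢
  have h1 : N ≤ m + T.card := by exact_mod_cast hge
  have h2 : m ≤ N - T.card := by exact_mod_cast hle
  congr 1
  omega

/-! ## §2 Stalks of closed subschemes and of opens -/

section Stalks

variable {X : Scheme.{u}}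

/-- **The local rings of `V(J)` are the quotient stalks `𝒪_{X,x}/J_x`** (a ring isomorphism:
`𝒪_{X,ι c} → 𝒪_{V(J),c}` is surjective with kernel `J_{ι c}`). [folklore] -/
theorem nonempty_stalkSubschemeEquiv (J : X.IdealSheafData) (c : J.subscheme) :
    Nonempty ((X.presheaf.stalk (J.subschemeι c) ⧸ stalkIdeal J (J.subschemeι c)) ≃+*
      J.subscheme.presheaf.stalk c) := by
  have hsurj : Function.Surjective (J.subschemeι.stalkMap c).hom := J.subschemeι.stalkMap_surjective c
  have e₁ : (X.presheaf.stalk (J.subschemeι c) ⧸ stalkIdeal J (J.subschemeι c)) ≃+*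
      (X.presheaf.stalk (J.subschemeι c) ⧸ RingHom.ker (J.subschemeι.stalkMap c).hom) :=
    Ideal.quotEquivOfEq (ker_stalkMap_subschemeι J c).symm
  exact ⟨e₁.trans (RingHom.quotientKerEquivOfSurjective hsurj)⟩

/-- The dimension of a local ring of `V(J)` is that of the quotient stalk. [folklore] -/
theorem ringKrullDim_stalk_subscheme (J : X.IdealSheafData) (c : J.subscheme) :
    ringKrullDim (J.subscheme.presheaf.stalk c) =
      ringKrullDim (X.presheaf.stalk (J.subschemeι c) ⧸ stalkIdeal J (J.subschemeι c)) :=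
  (ringKrullDim_eq_of_ringEquiv (nonempty_stalkSubschemeEquiv J c).some).symm

/-- The local rings of an open subscheme are those of the ambient scheme. [folklore] -/
theorem ringKrullDim_stalk_opens (V : X.Opens) (y : ↥(V : Scheme.{u})) :
    ringKrullDim ((V : Scheme.{u}).presheaf.stalk y) = ringKrullDim (X.presheaf.stalk (V.ι y)) := by
  haveI : IsIso (V.ι.stalkMap y) := (IsOpenImmersion.iff_isIso_stalkMap.mp inferInstance).2 y
  exact (ringKrullDim_eq_of_ringEquiv (asIso (V.ι.stalkMap y)).commRingCatIsoToRingEquiv).symm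

/-- A closed point has height `0` in the specialisation order of a scheme. This is Mathlib's
`AlgebraicGeometry.Scheme.height_of_isClosed`; kept as a deprecated alias (dedup-02487; a second
tree copy is `Motives.ProjFamily.height_eq_zero_of_isClosed_singleton`). [folklore] -/
@[deprecated AlgebraicGeometry.Scheme.height_of_isClosed (since := "2026-08-16")]
theorem height_eq_zero_of_isClosed_singleton {x : X} (hx : IsClosed ({x} : Set X)) :
    Order.height x = 0 :=
  Scheme.height_of_isClosed hx

/-- **At a closed point of an irreducible scheme smooth of relative dimension `n` over a field the
local ring has dimension `n`** (`height + coheight = n` with `height = 0`). [folklore] -/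
theorem ringKrullDim_stalk_eq_of_isClosed_singleton {K : Type u} [Field K]
    (f : X ⟶ Spec (CommRingCat.of K)) (n : ℕ) [SmoothOfRelativeDimension n f] [IrreducibleSpace X]
    {x : X} (hx : IsClosed ({x} : Set X)) : ringKrullDim (X.presheaf.stalk x) = n := by
  have h := Literature.AlgebraicGeometry.Motives.height_add_coheight_eq_of_smoothOfRelativeDimension f n x
  rw [Scheme.height_of_isClosed hx, zero_add] at h
  rw [ringKrullDim_stalk_eq_coheight, h]
  rfl

end Stalks

/-! ## §3 The strata -/

section Strata

variable {k : Type u} [Field k] [PerfectField k] {W : Scheme.{u}} (s : W ⟶ Spec (.of k))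
  {n : ℕ} [SmoothOfRelativeDimension n s] [IsIntegral W]
  {E : List W.IdealSheafData} (hE : HasSNC E) (S : Finset W.IdealSheafData) (hS : ∀ D ∈ S, D ∈ E)

include hE hS in
omit [PerfectField k] [SmoothOfRelativeDimension n s] [IsIntegral W] in
/-- **The quotient stalks of a stratum of an snc configuration**: for `x ∈ V(Σ_{D∈S} D)`,
`𝒪_{W,x} / (Σ_{D ∈ S} D)_x` is a regular local ring of dimension `dim 𝒪_{W,x} - |S|`. [folklore] -/
theorem isRegularLocalRing_and_ringKrullDim_quotient_stalkIdeal_stratum {x : W}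
    (hx : x ∈ (S.sup id).support) :
    IsRegularLocalRing (W.presheaf.stalk x ⧸ stalkIdeal (S.sup id) x) ∧
      ∃ N : ℕ, ringKrullDim (W.presheaf.stalk x) = N ∧ S.card ≤ N ∧
        ringKrullDim (W.presheaf.stalk x ⧸ stalkIdeal (S.sup id) x) = (N - S.card : ℕ) := by
  classical
  obtain ⟨hreg, u, hspan, ⟨ι, hιinj, hι⟩, -⟩ := hE x
  haveI := hreg
  have hN : ringKrullDim (W.presheaf.stalk x) = ((maximalIdeal (W.presheaf.stalk x)).spanFinrank : ℕ) :=
    (IsRegularLocalRing.spanFinrank_maximalIdeal).symm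
  have hxD : ∀ D ∈ S, x ∈ D.support := (mem_support_finsetSup_iff S x).mp hx
  -- the indices of the divisors of `S`
  let e : S → {D // D ∈ E ∧ x ∈ D.support} := fun D ↦ ⟨D.1, hS D.1 D.2, hxD D.1 D.2⟩
  have he : Function.Injective e := fun a b h ↦ Subtype.ext (congrArg (fun z ↦ z.1) h :)
  let T : Finset (Fin (maximalIdeal (W.presheaf.stalk x)).spanFinrank) := Finset.univ.image (ι ∘ e)
  have hTcard : T.card = S.card := by
    rw [Finset.card_image_of_injective _ (hιinj.comp he), Finset.card_univ, Fintype.card_coe]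
  have hJ : stalkIdeal (S.sup id) x = Ideal.span (u '' ↑T) := by
    rw [stalkIdeal_finsetSup]
    refine le_antisymm (Finset.sup_le fun D hD ↦ ?_) (Ideal.span_le.mpr ?_)
    · rw [hι (e ⟨D, hD⟩)]
      refine Ideal.span_le.mpr ?_
      rintro _ rfl
      exact Ideal.subset_span ⟨ι (e ⟨D, hD⟩), by simp [T], rfl⟩
    · rintro _ ⟨i, hi, rfl⟩
      simp only [T, Finset.coe_image, Finset.coe_univ, Set.image_univ, Set.mem_range,
        Function.comp_apply] at hi
      obtain ⟨D, rfl⟩ := hi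
      have hle : stalkIdeal D.1 x ≤ S.sup fun K ↦ stalkIdeal K x :=
        Finset.le_sup (f := fun K ↦ stalkIdeal K x) D.2
      refine hle ?_
      rw [show stalkIdeal (D.1 : W.IdealSheafData) x = stalkIdeal (e D).1 x from rfl, hι (e D)]
      exact Ideal.subset_span rfl
  obtain ⟨hq, hdim⟩ := isRegularLocalRing_and_ringKrullDim_quotient_span_image hN u hspan T
  rw [← hJ] at hq hdim
  refine ⟨hq, _, hN, ?_, hTcard ▸ hdim⟩
  -- `|S| ≤ N` as `T ⊆ Fin N` has `|S|` elements
  rw [← hTcard]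
  exact (T.card_le_univ).trans_eq (Fintype.card_fin _)

include hE hS in
omit [PerfectField k] [SmoothOfRelativeDimension n s] [IsIntegral W] in
/-- The strata of an snc configuration are regular schemes. [folklore] -/
theorem isRegular_stratum_of_hasSNC [LocallyOfFiniteType s] : Scheme.IsRegular (S.sup id).subscheme := by
  haveI : IsLocallyNoetherian W := LocallyOfFiniteType.isLocallyNoetherian s
  rw [Scheme.isRegular_subscheme_iff]
  exact fun x hx ↦ (isRegularLocalRing_and_ringKrullDim_quotient_stalkIdeal_stratum hE S hS hx).1

include hE hS in
/-- **The strata of a simple normal crossing configuration are smooth of the expected relative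
dimension**: `V(Σ_{D ∈ S} D) → Spec k` is smooth of relative dimension `n - |S|` for `W`
integral, smooth of relative dimension `n` over the perfect field `k`, and `S` a finite set of
members of the snc list `E` (Kollár 2007, 3.24; Voisin II §4.2.2).
[cite: Kollar2007, 3.24 (p. 125)] [cite: Matsumura1987, Thm. 14.2] -/
theorem smoothOfRelativeDimension_stratum_of_hasSNC [LocallyOfFiniteType s] :
    SmoothOfRelativeDimension (n - S.card) ((S.sup id).subschemeι ≫ s) := by
  classical
  haveI : IsLocallyNoetherian W := LocallyOfFiniteType.isLocallyNoetherian s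
  set J := S.sup id with hJdef
  set ES := J.subscheme
  set f : ES ⟶ Spec (.of k) := J.subschemeι ≫ s with hfdef
  have hreg : Scheme.IsRegular ES := isRegular_stratum_of_hasSNC s hE S hS
  haveI : Smooth f := smooth_of_isRegular_of_perfectField f hreg
  haveI : JacobsonSpace ES := LocallyOfFiniteType.jacobsonSpace f
  -- local relative dimensions
  choose V d hxV hV using Literature.AlgebraicGeometry.Motives.exists_opens_smoothOfRelativeDimension_of_smooth f
  -- dimension of the local rings of `ES`
  have hstalk : ∀ c : ES, ∃ N : ℕ, ringKrullDim (W.presheaf.stalk (J.subschemeι c)) = N ∧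
      S.card ≤ N ∧ ringKrullDim (ES.presheaf.stalk c) = (N - S.card : ℕ) := by
    intro c
    obtain ⟨-, N, hN, hle, hdim⟩ := isRegularLocalRing_and_ringKrullDim_quotient_stalkIdeal_stratum
      hE S hS (subschemeι_apply_mem_support J c)
    exact ⟨N, hN, hle, (ringKrullDim_stalk_subscheme J c).trans hdim⟩
  have hd : ∀ x, d x = n - S.card := by
    intro x
    haveI := hV x
    -- a closed point `c` of `ES` in `V x`
    obtain ⟨c₀, hc₀V, hc₀⟩ := nonempty_inter_closedPoints (X := ES) (Z := ((V x : ES.Opens) : Set ES))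
      ⟨x, hxV x⟩ (V x).2.isLocallyClosed
    rw [mem_closedPoints_iff] at hc₀
    set c : V x := ⟨c₀, hc₀V⟩
    -- `dim 𝒪_{W, ι c₀} = n`
    have hcW : IsClosed ({J.subschemeι c₀} : Set W) := by
      rw [← Set.image_singleton]
      exact J.subschemeι.isClosedEmbedding.isClosedMap _ hc₀
    have hdimW := ringKrullDim_stalk_eq_of_isClosed_singleton s n hcW
    obtain ⟨N, hN, hSN, hdimc⟩ := hstalk c₀
    have hNn : N = n := by
      rw [hN] at hdimW
      exact_mod_cast hdimW
    -- `dim 𝒪_{V, c} = n - |S| ≤ d x`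
    have h1 : ringKrullDim (((V x : ES.Opens) : Scheme.{u}).presheaf.stalk c) = (n - S.card : ℕ) := by
      rw [ringKrullDim_stalk_opens, ← hNn, ← hdimc]
      rfl
    have hge : n - S.card ≤ d x := by
      have := Literature.AlgebraicGeometry.Motives.ringKrullDim_stalk_le_of_smoothOfRelativeDimension
        ((V x).ι ≫ f) (d x) c
      rw [h1] at this
      exact_mod_cast this
    -- `d x ≤ n - |S|`: some local ring of `V x` has dimension `d x`
    obtain ⟨y, hy⟩ := Literature.AlgebraicGeometry.Motives.exists_ringKrullDim_stalk_eq_of_smoothOfRelativeDimension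
      ((V x).ι ≫ f) (d x) c
    have hle : d x ≤ n - S.card := by
      obtain ⟨N', hN', hSN', hdimy⟩ := hstalk ((V x).ι y)
      have hN'n : N' ≤ n := by
        have := Literature.AlgebraicGeometry.Motives.ringKrullDim_stalk_le_of_smoothOfRelativeDimension
          s n (J.subschemeι ((V x).ι y))
        rw [hN'] at this
        exact_mod_cast this
      rw [ringKrullDim_stalk_opens, hdimy] at hy
      have : d x = N' - S.card := by exact_mod_cast hy.symm
      omega
    exact le_antisymm hle hge
  -- glue
  have hcov : iSup V = ⊤ := by
    rw [eq_top_iff]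
    rintro x -
    simp only [TopologicalSpace.Opens.mem_iSup]
    exact ⟨x, hxV x⟩
  exact IsZariskiLocalAtSource.of_iSup_eq_top (P := @SmoothOfRelativeDimension (n - S.card)) V hcov
    fun x ↦ hd x ▸ hV x

end Strata

end Literature.AlgebraicGeometry.Resolution
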